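import Summits.QuantumFields.YangMills.Theorems.LuscherReductionTwistedTraceScalingTowerOfUniform
import Summits.QuantumFields.YangMills.Theorems.LuscherReductionTwistedTraceScalingUniformOfCoarse
import Summits.QuantumFields.YangMills.Theorems.FemtoTransferGapLevelsDecay
import Literature.Analysis.Complex.FarSetConformalDiameter
import HarnessLib

/-!
# S-TOWER of line «twolattice» (crux `TwistedTraceScaling`, stmt-QuantumFields-20203): the owner's typed helper targets T-A and T-B —
# `LogRatioMatch ⇒ S-TOWER` (RG-native currency) and `StepScalingMatch ∧ UniformTail ⇒ S-TOWER` (spectral currency), kernel-checked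

Route `LuscherReduction` (owner ym-beyond-p1), child crux `TwistedTraceScaling` (stmt-QuantumFields-20203), line «twolattice» (skeleton sha16
a5c3dbcbf75f28d1), stub S-TOWER `Stmt.stub_twoLatticeUniversality` (lead ym-lead-20203-twolattice g0).  The owner's LEAD-KIT (20203 evidence #16/#18,
`pub/ym-beyond/p1-g23-files/Sketch-TowerTargets.lean` sha16 eea030c6cb74bf7a) types two currencies in which an RG proof of S-TOWER would naturally conclude,
and asks for the reductions to the registered text as the lead's first helpers.  Both are proved here, with the currencies SPELLED OUT as hypothesis texts
(identical to the sketch's `Tower.LogRatioMatch` / `Tower.StepScalingMatch` / `Tower.UniformTail`; the conclusion is VERBATIM the body of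
`Stmt.stub_twoLatticeUniversality` = the sketch's `Tower.Stmt`):

* §1 a-priori size of the dyadic ratio deep in the window: `traceRatio L β T = levelRatio L β T ∈ (0, 1]` for `β ≥ 1`, `T ≥ 2` (`m(T) ≥ 1`, `0 ≤ m(2T) ≤ m(T)`;
  closed child `TraceFormula`), so `log` is not junk there; the elementary `|r − r₁| ≤ |log r − log r₁|` on `(0,1]` is the tree's
  `Literature.Analysis.Complex.FarSet.abs_sub_le_abs_log_sub_log` (reused, not restated).
* §2 ★ T-A `stmt_of_logRatioMatch : LogRatioMatch → S-TOWER` — WITHOUT the S-BASE hypothesis the sketch reserved for it: on `(0,1]` the exponential is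
  1-Lipschitz, `|r − r₁| = |e^{log r} − e^{log r₁}| ≤ |log r − log r₁|`; no positive lower bound on the coarse ratio is needed in this direction
  (it would be needed for the converse `S-TOWER ⇒ LogRatioMatch`).  The sketch's exact header `stmt_of_logRatioMatch_base` is derived (its first
  hypothesis is idle).
* §3 ★ T-B `stmt_of_match_tail : StepScalingMatch → UniformTail → S-TOWER`: per-level matching of `x_k^{⌈sL/Λ⌉}` below a tail cut `K`, ONE uniform tail
  serving both lattices (the coarse point is in the SAME window, `Tower.window_of_matched`), `2T`-moments by `x² − y² = (x+y)(x−y)` on `[0,1]`, and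
  `TraceDoor.ratio_sub_ratio_le`; thresholds combined as in `Tower.umoment_close` (`Σ L0_k`, `1/(Σ lam0_k⁻¹ + 1)`).

HONEST FRAMING: reductions only; `LogRatioMatch` (relative control of the last-scale blocked action vs Wilson's at `β₁`, Bałaban-type RG at fixed femto size)
and `StepScalingMatch` (Lüscher–Weisz–Wolff step-scaling universality level by level) are OPEN and XL; femto rung R2b1 only; not infinite volume, not a gap,
not Clay.  No definitions, no new named facts.
-/

set_option autoImplicit false

noncomputable section

open MeasureTheory Filter Topology Real
open Literature.MathematicalPhysics.QuantumFieldTheory hiding SU2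
open Literature.MathematicalPhysics.QuantumLattice
open Literature.Analysis.OperatorTheory.YMMatrixModel
open scoped BigOperators

namespace Summit.QuantumFields.YangMills.Theorems.FemtoTransferGap.TwoLattice

open Summit.QuantumFields.YangMills.Theorems.FemtoTransferGap
open Summit.QuantumFields.YangMills.Theorems.FemtoTransferGap.TraceDoor
open Summit.QuantumFields.YangMills.Theorems.FemtoTransferGap.TT (physTrace)

namespace Tower

/-! ## §1 A-priori size of the dyadic ratio: `levelRatio ∈ (0, 1]` -/

/-- The relative levels lie in `[0, 1]` (`β ≥ 0`). [cite: ReedSimonIV1978, Thm. XIII.1] -/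
theorem xval_mem {L : ℕ} [NeZero L] {β : ℝ} (hβ : 0 < β) (k : ℕ) :
    0 ≤ levelValue su2Rep L β k / levelValue su2Rep L β 0 ∧ levelValue su2Rep L β k / levelValue su2Rep L β 0 ≤ 1 := by
  have h0 : 0 < levelValue su2Rep L β 0 := levelValue_zero_su2Rep_pos L β
  refine ⟨div_nonneg (levelValue_su2Rep_nonneg L hβ.le k) h0.le, ?_⟩
  rw [div_le_one h0]
  exact levelValue_le_of_le hβ (Nat.zero_le k)

/-- Level moments: `m(T) ≥ 1`, `0 ≤ m(2T) ≤ m(T)` (`β ≥ 1`, `T ≥ 2`). [cite: Luscher1983, §3] -/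
theorem levelMoment_bounds (L : ℕ) [NeZero L] {β : ℝ} (hβ : 1 ≤ β) {T : ℕ} (hT : 2 ≤ T) :
    1 ≤ levelMoment L β T ∧ 0 ≤ levelMoment L β (2 * T) ∧ levelMoment L β (2 * T) ≤ levelMoment L β T := by
  have hβ0 : (0 : ℝ) < β := by linarith
  have hsum := Base.summable_xpow L hβ hT
  have hsum2 := Base.summable_xpow L hβ (by omega : 2 ≤ 2 * T)
  have hx := fun k => xval_mem (L := L) hβ0 k
  refine ⟨?_, tsum_nonneg fun k => pow_nonneg (hx k).1 _, ?_⟩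
  · have h := hsum.le_tsum 0 (fun j _ => pow_nonneg (hx j).1 T)
    have h0 : (levelValue su2Rep L β 0 / levelValue su2Rep L β 0) ^ T = 1 := by
      rw [div_self (levelValue_zero_su2Rep_pos L β).ne', one_pow]
    unfold levelMoment; rw [h0] at h; exact h
  · unfold levelMoment
    refine Summable.tsum_le_tsum (fun k => ?_) hsum2 hsum
    exact pow_le_pow_of_le_one (hx k).1 (hx k).2 (by omega)

/-- Deep in the window the dyadic trace ratio is a genuine number in `(0, 1]` (`β ≥ 1`, `T ≥ 2`). [cite: Luscher1983, §3] -/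
theorem traceRatio_mem (L : ℕ) [NeZero L] {β : ℝ} (hβ : 1 ≤ β) {T : ℕ} (hT : 2 ≤ T) :
    0 < traceRatio L β T ∧ traceRatio L β T ≤ 1 := by
  rw [Base.traceRatio_eq_levelRatio L hβ hT]
  obtain ⟨h1, h2, h3⟩ := levelMoment_bounds L hβ hT
  have hpos : 0 < levelMoment L β T := by linarith
  unfold levelRatio
  constructor
  · -- `m(2T) ≥ x_0^{2T} = 1 > 0`
    obtain ⟨h1', _, _⟩ := levelMoment_bounds L hβ (by omega : 2 ≤ 2 * T)
    exact div_pos (by linarith) (by positivity)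
  · rw [div_le_one (by positivity)]
    calc levelMoment L β (2 * T) ≤ levelMoment L β T := h3
      _ = levelMoment L β T * 1 := (mul_one _).symm
      _ ≤ levelMoment L β T * levelMoment L β T := mul_le_mul_of_nonneg_left h1 hpos.le
      _ = levelMoment L β T ^ 2 := (sq _).symm

/-! ## §2 ★ T-A: `LogRatioMatch ⇒ S-TOWER` -/

/-- ★ **T-A: S-TOWER from the RG-native currency `LogRatioMatch`** (conclusion = VERBATIM body of `Stmt.stub_twoLatticeUniversality`; hypothesis = the
sketch's `Tower.LogRatioMatch` text).  Deep in the window (`lam ≤ s/4` forces `T ≥ 2` on both lattices, which share the window) both ratios lie in `(0,1]`,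
where `|r − r₁| ≤ |log r − log r₁|`.  No S-BASE input is needed in this direction. [cite: LuscherWeiszWolff1991, §2] [cite: Balaban1989LargeFieldII, pp. 355–6] -/
theorem stmt_of_logRatioMatch
    (hLog : ∀ s : ℝ, 0 < s → ∀ ε : ℝ, 0 < ε → ∃ L0 : ℕ, ∃ lam0 : ℝ, 0 < lam0 ∧ ∀ lam : ℝ, 0 < lam → lam ≤ lam0 →
      ∀ (L1 : ℕ) [NeZero L1], L0 ≤ L1 → ∀ (L : ℕ) [NeZero L], L1 ≤ L → ∀ β : ℝ, InFemtoWindow lam β L →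
        ∀ β₁ : ℝ, 1 ≤ β₁ → invRunningCoupling β₁ L1 = invRunningCoupling β L →
          |Real.log (traceRatio L β (femtoSteps s β L)) - Real.log (traceRatio L1 β₁ (femtoSteps s β₁ L1))| ≤ ε) :
    ∀ s : ℝ, 0 < s → ∀ ε : ℝ, 0 < ε → ∃ L0 : ℕ, ∃ lam0 : ℝ, 0 < lam0 ∧ ∀ lam : ℝ, 0 < lam → lam ≤ lam0 →
      ∀ (L1 : ℕ) [NeZero L1], L0 ≤ L1 → ∀ (L : ℕ) [NeZero L], L1 ≤ L → ∀ β : ℝ, InFemtoWindow lam β L →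
        ∀ β₁ : ℝ, 1 ≤ β₁ → invRunningCoupling β₁ L1 = invRunningCoupling β L →
          |traceRatio L β (femtoSteps s β L) - traceRatio L1 β₁ (femtoSteps s β₁ L1)| ≤ ε := by
  intro s hs ε hε
  obtain ⟨L0, lam0, hlam0, H⟩ := hLog s hs ε hε
  refine ⟨L0, min lam0 (s / 4), lt_min hlam0 (by positivity), ?_⟩
  intro lam hlam hle L1 _ hL1 L _ hL β hW β₁ hβ₁ hmatch
  have hle0 : lam ≤ lam0 := hle.trans (min_le_left _ _)
  have hles : lam ≤ s / 4 := hle.trans (min_le_right _ _)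
  have hW₁ : InFemtoWindow lam β₁ L1 := window_of_matched hW hβ₁ hmatch
  have hMpos : (0 : ℝ) < 1 := one_pos
  obtain ⟨hβ1, _, hT2⟩ := deepT hs hlam hles hW
  obtain ⟨hβ₁1, _, hT2₁⟩ := deepT hs hlam hles hW₁
  obtain ⟨hr, hr1⟩ := traceRatio_mem L hβ1 hT2
  obtain ⟨hr₁, hr₁1⟩ := traceRatio_mem L1 hβ₁1 hT2₁
  exact (Literature.Analysis.Complex.FarSet.abs_sub_le_abs_log_sub_log hr hr1 hr₁ hr₁1).trans (H lam hlam hle0 L1 hL1 L hL β hW β₁ hβ₁ hmatch)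
where
  /-- deep in a window of depth `lam ≤ s/4`: `β ≥ 1`, `u > 0`, `T ≥ 2` -/
  deepT {s lam β : ℝ} {L : ℕ} [NeZero L] (hs : 0 < s) (hlam : 0 < lam) (hs4 : lam ≤ s / 4) (hW : InFemtoWindow lam β L) :
      1 ≤ β ∧ 0 < luscherLambda β L / L ∧ 2 ≤ femtoSteps s β L := by
    obtain ⟨hβ, hupos, hule⟩ := unit_small_of_window (τ := s / 2) hlam (by linarith) hW
    obtain ⟨hT1, _⟩ := Base.femtoSteps_mul_unit (L1 := L) hs.le hlam hW
    have h1' : (2 : ℝ) * (luscherLambda β L / L) ≤ (femtoSteps s β L : ℝ) * (luscherLambda β L / L) := by linarith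
    have h2 : (2 : ℝ) ≤ (femtoSteps s β L : ℝ) := le_of_mul_le_mul_right h1' hupos
    exact ⟨hβ, hupos, by exact_mod_cast h2⟩

/-- The sketch's exact header T-A `stmt_of_logRatioMatch_base` (`pub/ym-beyond/p1-g23-files/Sketch-TowerTargets.lean`): the S-BASE hypothesis reserved
there is not needed (`stmt_of_logRatioMatch`); kept for the record with the hypothesis marked idle. [cite: LuscherWeiszWolff1991, §2] -/
theorem stmt_of_logRatioMatch_base
    (_hBase : ∀ (L1 : ℕ) [NeZero L1] (s : ℝ), 0 < s → ∀ ε : ℝ, 0 < ε → ∃ β1 : ℝ, ∀ β : ℝ, β1 ≤ β →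
      |traceRatio L1 β (femtoSteps s β L1) - hTraceRatio s| ≤ ε)
    (hLog : ∀ s : ℝ, 0 < s → ∀ ε : ℝ, 0 < ε → ∃ L0 : ℕ, ∃ lam0 : ℝ, 0 < lam0 ∧ ∀ lam : ℝ, 0 < lam → lam ≤ lam0 →
      ∀ (L1 : ℕ) [NeZero L1], L0 ≤ L1 → ∀ (L : ℕ) [NeZero L], L1 ≤ L → ∀ β : ℝ, InFemtoWindow lam β L →
        ∀ β₁ : ℝ, 1 ≤ β₁ → invRunningCoupling β₁ L1 = invRunningCoupling β L →
          |Real.log (traceRatio L β (femtoSteps s β L)) - Real.log (traceRatio L1 β₁ (femtoSteps s β₁ L1))| ≤ ε) :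
    ∀ s : ℝ, 0 < s → ∀ ε : ℝ, 0 < ε → ∃ L0 : ℕ, ∃ lam0 : ℝ, 0 < lam0 ∧ ∀ lam : ℝ, 0 < lam → lam ≤ lam0 →
      ∀ (L1 : ℕ) [NeZero L1], L0 ≤ L1 → ∀ (L : ℕ) [NeZero L], L1 ≤ L → ∀ β : ℝ, InFemtoWindow lam β L →
        ∀ β₁ : ℝ, 1 ≤ β₁ → invRunningCoupling β₁ L1 = invRunningCoupling β L →
          |traceRatio L β (femtoSteps s β L) - traceRatio L1 β₁ (femtoSteps s β₁ L1)| ≤ ε :=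
  stmt_of_logRatioMatch hLog

/-! ## §3 ★ T-B: `StepScalingMatch ∧ UniformTail ⇒ S-TOWER` -/

set_option maxHeartbeats 400000 in
/-- **Two-lattice moment matching** (engine of T-B): deep in the window, at matched label, `|m_L(T) − m_{L₁}(T₁)| ≤ ε` and `|m_L(2T) − m_{L₁}(2T₁)| ≤ ε`
(`T = ⌈sL/Λ⌉`, `T₁ = ⌈sL₁/Λ⌉`), together with `β, β₁ ≥ 1`, `T, T₁ ≥ 2`.  Head `k < K` by `StepScalingMatch`, tails by ONE `UniformTail(s, ·)` on both lattices,
squares by `|x² − y²| ≤ 2|x − y|` on `[0,1]`. [cite: LuscherWeiszWolff1991, §2] [cite: Luscher1983, §3] -/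
theorem moments_match
    (hMatch : ∀ k : ℕ, ∀ s : ℝ, 0 < s → ∀ ε : ℝ, 0 < ε → ∃ L0 : ℕ, ∃ lam0 : ℝ, 0 < lam0 ∧ ∀ lam : ℝ, 0 < lam → lam ≤ lam0 →
      ∀ (L1 : ℕ) [NeZero L1], L0 ≤ L1 → ∀ (L : ℕ) [NeZero L], L1 ≤ L → ∀ β : ℝ, InFemtoWindow lam β L →
        ∀ β₁ : ℝ, 1 ≤ β₁ → invRunningCoupling β₁ L1 = invRunningCoupling β L →
          |(levelValue su2Rep L β k / levelValue su2Rep L β 0) ^ femtoSteps s β L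
            - (levelValue su2Rep L1 β₁ k / levelValue su2Rep L1 β₁ 0) ^ femtoSteps s β₁ L1| ≤ ε)
    (hTail : ∀ s : ℝ, 0 < s → ∀ ε : ℝ, 0 < ε → ∃ K : ℕ, ∃ L0 : ℕ, ∃ lam0 : ℝ, 0 < lam0 ∧ ∀ lam : ℝ, 0 < lam → lam ≤ lam0 →
      ∀ (L : ℕ) [NeZero L], L0 ≤ L → ∀ β : ℝ, InFemtoWindow lam β L →
        ∀ T : ℕ, s ≤ 2 * ((T : ℝ) * (luscherLambda β L / L)) →
          ∑' k : ℕ, (levelValue su2Rep L β (k + K) / levelValue su2Rep L β 0) ^ T ≤ ε)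
    {s : ℝ} (hs : 0 < s) {ε : ℝ} (hε : 0 < ε) :
    ∃ L0 : ℕ, ∃ lam0 : ℝ, 0 < lam0 ∧ ∀ lam : ℝ, 0 < lam → lam ≤ lam0 →
      ∀ (L1 : ℕ) [NeZero L1], L0 ≤ L1 → ∀ (L : ℕ) [NeZero L], L1 ≤ L → ∀ β : ℝ, InFemtoWindow lam β L →
        ∀ β₁ : ℝ, 1 ≤ β₁ → invRunningCoupling β₁ L1 = invRunningCoupling β L →
          1 ≤ β ∧ 1 ≤ β₁ ∧ 2 ≤ femtoSteps s β L ∧ 2 ≤ femtoSteps s β₁ L1 ∧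
          |levelMoment L β (femtoSteps s β L) - levelMoment L1 β₁ (femtoSteps s β₁ L1)| ≤ ε ∧
          |levelMoment L β (2 * femtoSteps s β L) - levelMoment L1 β₁ (2 * femtoSteps s β₁ L1)| ≤ ε := by
  have hε4 : 0 < ε / 4 := by positivity
  obtain ⟨K, L0T, lamT, hlamT, hT⟩ := hTail s hs (ε / 4) hε4
  have hδ : 0 < ε / (4 * ((K : ℝ) + 1)) := by positivity
  choose L0k lamk hlamk hk using fun k => hMatch k s hs (ε / (4 * ((K : ℝ) + 1))) hδ
  set L0fin : ℕ := ∑ k ∈ Finset.range K, L0k k with hL0fin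
  set lamfin : ℝ := 1 / (∑ j ∈ Finset.range K, (lamk j)⁻¹ + 1) with hlamfin
  have hlamfin_pos : 0 < lamfin := recipSum_pos hlamk
  refine ⟨max L0T L0fin, min (min lamT lamfin) (s / 4), lt_min (lt_min hlamT hlamfin_pos) (by positivity), ?_⟩
  intro lam hlam hle L1 _ hL1 L _ hL β hW β₁ hβ₁ hmatch
  have hleT : lam ≤ lamT := hle.trans ((min_le_left _ _).trans (min_le_left _ _))
  have hlefin : lam ≤ lamfin := hle.trans ((min_le_left _ _).trans (min_le_right _ _))
  have hles : lam ≤ s / 4 := hle.trans (min_le_right _ _)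
  have hW₁ : InFemtoWindow lam β₁ L1 := window_of_matched hW hβ₁ hmatch
  obtain ⟨hβ1, hupos, hT2⟩ := stmt_of_logRatioMatch.deepT hs hlam hles hW
  obtain ⟨hβ₁1, hupos₁, hT2₁⟩ := stmt_of_logRatioMatch.deepT hs hlam hles hW₁
  refine ⟨hβ1, hβ₁1, hT2, hT2₁, ?_⟩
  set T := femtoSteps s β L with hTdef
  set T₁ := femtoSteps s β₁ L1 with hT₁def
  -- notation
  set f : ℕ → ℝ := fun k => (levelValue su2Rep L β k / levelValue su2Rep L β 0) ^ T with hf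
  set g : ℕ → ℝ := fun k => (levelValue su2Rep L1 β₁ k / levelValue su2Rep L1 β₁ 0) ^ T₁ with hg
  have hβ0 : (0 : ℝ) < β := by linarith
  have hβ₁0 : (0 : ℝ) < β₁ := by linarith
  have hxL := fun k => xval_mem (L := L) hβ0 k
  have hx1 := fun k => xval_mem (L := L1) hβ₁0 k
  have hf01 : ∀ k, 0 ≤ f k ∧ f k ≤ 1 := fun k => ⟨pow_nonneg (hxL k).1 _, pow_le_one₀ (hxL k).1 (hxL k).2⟩
  have hg01 : ∀ k, 0 ≤ g k ∧ g k ≤ 1 := fun k => ⟨pow_nonneg (hx1 k).1 _, pow_le_one₀ (hx1 k).1 (hx1 k).2⟩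
  -- summability and the `2T` rewriting `x^{2T} = (x^T)^2`
  have hsumf : Summable f := Base.summable_xpow L hβ1 hT2
  have hsumg : Summable g := Base.summable_xpow L1 hβ₁1 hT2₁
  have hf2 : (fun k => (levelValue su2Rep L β k / levelValue su2Rep L β 0) ^ (2 * T)) = fun k => f k ^ 2 := by
    funext k; rw [hf]; dsimp only; rw [← pow_mul, mul_comm]
  have hg2 : (fun k => (levelValue su2Rep L1 β₁ k / levelValue su2Rep L1 β₁ 0) ^ (2 * T₁)) = fun k => g k ^ 2 := by
    funext k; rw [hg]; dsimp only; rw [← pow_mul, mul_comm]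
  have hsumf2 : Summable (fun k => f k ^ 2) := by rw [← hf2]; exact Base.summable_xpow L hβ1 (by omega)
  have hsumg2 : Summable (fun k => g k ^ 2) := by rw [← hg2]; exact Base.summable_xpow L1 hβ₁1 (by omega)
  -- tails (one `UniformTail` for both lattices: same window, both `≥ L0T`)
  obtain ⟨hTu, _⟩ := Base.femtoSteps_mul_unit (L1 := L) hs.le hlam hW
  obtain ⟨hTu₁, _⟩ := Base.femtoSteps_mul_unit (L1 := L1) hs.le hlam hW₁
  have hT0 : (0 : ℝ) ≤ (T : ℝ) * (luscherLambda β L / L) := by positivity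
  have hT0₁ : (0 : ℝ) ≤ (T₁ : ℝ) * (luscherLambda β₁ L1 / L1) := by positivity
  have hwin : s ≤ 2 * ((T : ℝ) * (luscherLambda β L / L)) := by rw [hTdef] at hT0 ⊢; linarith only [hT0, hTu]
  have hwin₁ : s ≤ 2 * ((T₁ : ℝ) * (luscherLambda β₁ L1 / L1)) := by
    rw [hT₁def] at hT0₁ ⊢; linarith only [hT0₁, hTu₁]
  have htf : ∑' k, f (k + K) ≤ ε / 4 := hT lam hlam hleT L (((le_max_left _ _).trans hL1).trans hL) β hW T hwin
  have htg : ∑' k, g (k + K) ≤ ε / 4 := hT lam hlam hleT L1 ((le_max_left _ _).trans hL1) β₁ hW₁ T₁ hwin₁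
  have htf2 : ∑' k, f (k + K) ^ 2 ≤ ε / 4 := by
    refine le_trans (Summable.tsum_le_tsum (fun k => ?_) ((summable_nat_add_iff K).2 hsumf2) ((summable_nat_add_iff K).2 hsumf)) htf
    exact pow_le_of_le_one (hf01 (k + K)).1 (hf01 (k + K)).2 two_ne_zero
  have htg2 : ∑' k, g (k + K) ^ 2 ≤ ε / 4 := by
    refine le_trans (Summable.tsum_le_tsum (fun k => ?_) ((summable_nat_add_iff K).2 hsumg2) ((summable_nat_add_iff K).2 hsumg)) htg
    exact pow_le_of_le_one (hg01 (k + K)).1 (hg01 (k + K)).2 two_ne_zero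
  have htf0 : 0 ≤ ∑' k, f (k + K) := tsum_nonneg fun k => (hf01 _).1
  have htg0 : 0 ≤ ∑' k, g (k + K) := tsum_nonneg fun k => (hg01 _).1
  have htf20 : 0 ≤ ∑' k, f (k + K) ^ 2 := tsum_nonneg fun k => sq_nonneg _
  have htg20 : 0 ≤ ∑' k, g (k + K) ^ 2 := tsum_nonneg fun k => sq_nonneg _
  -- heads
  have hhead : ∀ k ∈ Finset.range K, |f k - g k| ≤ ε / (4 * ((K : ℝ) + 1)) := by
    intro k hk'
    have hLk : L0k k ≤ L1 := (Finset.single_le_sum (f := fun k => L0k k) (fun i _ => Nat.zero_le _) hk').trans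
      ((le_max_right _ _).trans hL1)
    have hlk : lam ≤ lamk k := hlefin.trans (recipSum_le hlamk hk')
    exact hk k lam hlam hlk L1 hLk L hL β hW β₁ hβ₁ hmatch
  have hKfrac : (K : ℝ) * (ε / (4 * ((K : ℝ) + 1))) ≤ ε / 4 := by
    have hK1 : (0 : ℝ) < (K : ℝ) + 1 := by positivity
    rw [show (K : ℝ) * (ε / (4 * ((K : ℝ) + 1))) = ε / 4 * ((K : ℝ) / ((K : ℝ) + 1)) by field_simp]
    have : (K : ℝ) / ((K : ℝ) + 1) ≤ 1 := by rw [div_le_one hK1]; linarith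
    calc ε / 4 * ((K : ℝ) / ((K : ℝ) + 1)) ≤ ε / 4 * 1 := mul_le_mul_of_nonneg_left this hε4.le
      _ = ε / 4 := mul_one _
  have hhead1 : |∑ k ∈ Finset.range K, f k - ∑ k ∈ Finset.range K, g k| ≤ ε / 4 := by
    rw [← Finset.sum_sub_distrib]
    refine (Finset.abs_sum_le_sum_abs _ _).trans ?_
    refine (Finset.sum_le_sum hhead).trans ?_
    rw [Finset.sum_const, Finset.card_range, nsmul_eq_mul]; exact hKfrac
  have hhead2 : |∑ k ∈ Finset.range K, f k ^ 2 - ∑ k ∈ Finset.range K, g k ^ 2| ≤ 2 * (ε / 4) := by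
    rw [← Finset.sum_sub_distrib]
    refine (Finset.abs_sum_le_sum_abs _ _).trans ?_
    have : ∀ k ∈ Finset.range K, |f k ^ 2 - g k ^ 2| ≤ 2 * (ε / (4 * ((K : ℝ) + 1))) := by
      intro k hk'
      rw [sq_sub_sq, abs_mul]
      have hsum1 : |f k + g k| ≤ 2 := by
        rw [abs_of_nonneg (by linarith only [(hf01 k).1, (hg01 k).1])]; linarith only [(hf01 k).2, (hg01 k).2]
      exact mul_le_mul hsum1 (hhead k hk') (abs_nonneg _) (by norm_num)
    refine (Finset.sum_le_sum this).trans ?_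
    rw [Finset.sum_const, Finset.card_range, nsmul_eq_mul]
    calc (K : ℝ) * (2 * (ε / (4 * ((K : ℝ) + 1)))) = 2 * ((K : ℝ) * (ε / (4 * ((K : ℝ) + 1)))) := by ring
      _ ≤ 2 * (ε / 4) := by linarith [hKfrac]
  -- assemble
  have hm : levelMoment L β T = ∑ k ∈ Finset.range K, f k + ∑' k, f (k + K) := by
    unfold levelMoment; rw [← hsumf.sum_add_tsum_nat_add K]
  have hm₁ : levelMoment L1 β₁ T₁ = ∑ k ∈ Finset.range K, g k + ∑' k, g (k + K) := by
    unfold levelMoment; rw [← hsumg.sum_add_tsum_nat_add K]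
  have hm2 : levelMoment L β (2 * T) = ∑ k ∈ Finset.range K, f k ^ 2 + ∑' k, f (k + K) ^ 2 := by
    unfold levelMoment; rw [hf2, ← hsumf2.sum_add_tsum_nat_add K]
  have hm2₁ : levelMoment L1 β₁ (2 * T₁) = ∑ k ∈ Finset.range K, g k ^ 2 + ∑' k, g (k + K) ^ 2 := by
    unfold levelMoment; rw [hg2, ← hsumg2.sum_add_tsum_nat_add K]
  constructor
  · rw [hm, hm₁]
    calc |(∑ k ∈ Finset.range K, f k + ∑' k, f (k + K)) - (∑ k ∈ Finset.range K, g k + ∑' k, g (k + K))|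
        = |(∑ k ∈ Finset.range K, f k - ∑ k ∈ Finset.range K, g k) + (∑' k, f (k + K) - ∑' k, g (k + K))| := by
          congr 1; ring
      _ ≤ |∑ k ∈ Finset.range K, f k - ∑ k ∈ Finset.range K, g k| + |∑' k, f (k + K) - ∑' k, g (k + K)| := abs_add_le _ _
      _ ≤ ε / 4 + (ε / 4 + ε / 4) :=
          add_le_add hhead1 (by rw [abs_le]; constructor <;> linarith only [htf, htg, htf0, htg0])
      _ ≤ ε := by linarith only [hε]
  · rw [hm2, hm2₁]
    calc |(∑ k ∈ Finset.range K, f k ^ 2 + ∑' k, f (k + K) ^ 2) - (∑ k ∈ Finset.range K, g k ^ 2 + ∑' k, g (k + K) ^ 2)|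
        = |(∑ k ∈ Finset.range K, f k ^ 2 - ∑ k ∈ Finset.range K, g k ^ 2) + (∑' k, f (k + K) ^ 2 - ∑' k, g (k + K) ^ 2)| := by
          congr 1; ring
      _ ≤ |∑ k ∈ Finset.range K, f k ^ 2 - ∑ k ∈ Finset.range K, g k ^ 2| + |∑' k, f (k + K) ^ 2 - ∑' k, g (k + K) ^ 2| :=
          abs_add_le _ _
      _ ≤ 2 * (ε / 4) + (ε / 4 + ε / 4) :=
          add_le_add hhead2 (by rw [abs_le]; constructor <;> linarith only [htf2, htg2, htf20, htg20])
      _ ≤ ε := by linarith only [hε]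

/-- ★ **T-B: S-TOWER from the spectral currency `StepScalingMatch ∧ UniformTail`** (conclusion = VERBATIM body of `Stmt.stub_twoLatticeUniversality`;
hypotheses = the sketch's `Tower.StepScalingMatch` and `Tower.UniformTail` texts).  By `moments_match` at `ε/3` and
`TraceDoor.ratio_sub_ratio_le` (`m ≥ 1`, `0 ≤ m(2T₁) ≤ m(T₁)`), through LEVEL = TRACE on both lattices. [cite: LuscherWeiszWolff1991, §2] [cite: Luscher1983, §3] -/
theorem stmt_of_match_tail
    (hMatch : ∀ k : ℕ, ∀ s : ℝ, 0 < s → ∀ ε : ℝ, 0 < ε → ∃ L0 : ℕ, ∃ lam0 : ℝ, 0 < lam0 ∧ ∀ lam : ℝ, 0 < lam → lam ≤ lam0 →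
      ∀ (L1 : ℕ) [NeZero L1], L0 ≤ L1 → ∀ (L : ℕ) [NeZero L], L1 ≤ L → ∀ β : ℝ, InFemtoWindow lam β L →
        ∀ β₁ : ℝ, 1 ≤ β₁ → invRunningCoupling β₁ L1 = invRunningCoupling β L →
          |(levelValue su2Rep L β k / levelValue su2Rep L β 0) ^ femtoSteps s β L
            - (levelValue su2Rep L1 β₁ k / levelValue su2Rep L1 β₁ 0) ^ femtoSteps s β₁ L1| ≤ ε)
    (hTail : ∀ s : ℝ, 0 < s → ∀ ε : ℝ, 0 < ε → ∃ K : ℕ, ∃ L0 : ℕ, ∃ lam0 : ℝ, 0 < lam0 ∧ ∀ lam : ℝ, 0 < lam → lam ≤ lam0 →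
      ∀ (L : ℕ) [NeZero L], L0 ≤ L → ∀ β : ℝ, InFemtoWindow lam β L →
        ∀ T : ℕ, s ≤ 2 * ((T : ℝ) * (luscherLambda β L / L)) →
          ∑' k : ℕ, (levelValue su2Rep L β (k + K) / levelValue su2Rep L β 0) ^ T ≤ ε) :
    ∀ s : ℝ, 0 < s → ∀ ε : ℝ, 0 < ε → ∃ L0 : ℕ, ∃ lam0 : ℝ, 0 < lam0 ∧ ∀ lam : ℝ, 0 < lam → lam ≤ lam0 →
      ∀ (L1 : ℕ) [NeZero L1], L0 ≤ L1 → ∀ (L : ℕ) [NeZero L], L1 ≤ L → ∀ β : ℝ, InFemtoWindow lam β L →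
        ∀ β₁ : ℝ, 1 ≤ β₁ → invRunningCoupling β₁ L1 = invRunningCoupling β L →
          |traceRatio L β (femtoSteps s β L) - traceRatio L1 β₁ (femtoSteps s β₁ L1)| ≤ ε := by
  intro s hs ε hε
  obtain ⟨L0, lam0, hlam0, H⟩ := moments_match hMatch hTail hs (by positivity : 0 < ε / 3)
  refine ⟨L0, lam0, hlam0, ?_⟩
  intro lam hlam hle L1 _ hL1 L _ hL β hW β₁ hβ₁ hmatch
  obtain ⟨hβ1, hβ₁1, hT2, hT2₁, hm, hm2⟩ := H lam hlam hle L1 hL1 L hL β hW β₁ hβ₁ hmatch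
  rw [Base.traceRatio_eq_levelRatio L hβ1 hT2, Base.traceRatio_eq_levelRatio L1 hβ₁1 hT2₁]
  obtain ⟨hB, _, _⟩ := levelMoment_bounds L hβ1 hT2
  obtain ⟨hB', hA', hA'B'⟩ := levelMoment_bounds L1 hβ₁1 hT2₁
  unfold levelRatio
  refine (ratio_sub_ratio_le hB hB' hA' hA'B').trans ?_
  linarith only [hm, hm2]

end Tower

end Summit.QuantumFields.YangMills.Theorems.FemtoTransferGap.TwoLattice

end
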